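import Literature.Analysis.FluidPDE.LimitLerayHopf
import Literature.Analysis.FluidPDE.TaoForcedFiniteEnergyLerayHopfL2
import HarnessLib

/-!
# Leray–Hopf solutions of the FORCED system as uniform `L²` limits of smooth
# bounded-enstrophy solutions

Analysis/FluidPDE proof file (no named facts, no definitions). This is the forced twin of the
tree's `exists_isLerayHopfOn_of_uniform_cauchy` (`LimitLerayHopf.lean`). Let `uⁿ` be classical
solutions of the Navier–Stokes system with one COMMON force `f` on `[0, T] × ℝ³`, with
`uⁿ ∈ C([0,T]; L²)`, kinetic energies `E(uⁿ(t)) ≤ M` and enstrophies `∫|∇uⁿ(t)|² ≤ S` bounded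
uniformly in `n` and `t ∈ [0, T]`, force slices `∫|f(t)|² ≤ C_f < ∞` on `[0, T]`, which are
Cauchy in `C([0,T]; L²)` and whose data converge in `L²` to `u₀`. Then the (a.e. pointwise) limit
`v` is a Leray–Hopf weak solution of the FORCED system on `[0, T)` from `u₀`
(`IsLerayHopfOn T ν f u₀ v`: weak formulation WITH the source term `∫∫⟪f, ψ⟫`, energy
inequalities WITH the work term `∫ₛᵗ∫⟪f, v⟫`), with `v 0 = u₀`, `v ∈ C([0,T]; L²)` and
`uⁿ(t) → v(t)` in `L²` for every `t ∈ [0, T]` (`exists_isLerayHopfOn_of_uniform_cauchy_forced`).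

This is the limit step in the approximation proof of Tao 2013, Thm. 5.4 (ii) for `H¹` data in the
inhomogeneous case (Robinson–Rodrigo–Sadowski 2016, proof of Thm. 4.10 / Thm. 6.8:
Galerkin/smooth approximations, uniform bounds, passage to the limit in the weak formulation,
energy inequality by lower semicontinuity — the body force enters the weak formulation and the
energy inequality LINEARLY, RRS (4.2)/(4.4) with `f`; Ożański–Pooley 2018, proof of Thm. 6.37,
Steps 3–4). Compared with the homogeneous file, the only new inputs are: the weak formulation of
the approximants WITH force (`IsClassicalNSSolutionOn.isWeakNSSolutionOn_holds`, force-agnostic),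
the forced energy EQUALITY of the approximants in the energy class
(`IsClassicalNSSolutionOn.energyEq_of_finiteEnergy_forced_L2_of_energy`, Tao 2013 Lemma 8.1 with
force), and the convergence of the work `∫ₛᵗ∫⟪f, uⁿ⟫ → ∫ₛᵗ∫⟪f, v⟫` and of the source term, both
by dominated convergence in time from the slice-wise strong `L²` convergence. In the forced case
the energies of the approximants are not decreasing, so the uniform energy bound `M` is a
hypothesis (the assembler obtains it from the forced energy balance); no spatial Sobolev bounds of
`uⁿ` or of the pressures are needed here beyond smoothness.

## References

* J. C. Robinson, J. L. Rodrigo, W. Sadowski, *The three-dimensional Navier–Stokes equations*,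
  CUP 2016, proof of Thm. 4.10 and Thm. 6.8 (with body force: (4.2), (4.4)).
  [RobinsonRodrigoSadowski2016]
* W. S. Ożański, B. C. Pooley, LMS Lecture Notes 452, CUP 2018, proof of Thm. 6.37, Steps 3–4.
  [OzanskiPooley2018]
* T. Tao, Localisation and compactness properties of the Navier–Stokes global regularity problem,
  Anal. PDE 6 (2013), Thm. 5.4, Lemma 8.1. [Tao2011]
-/

noncomputable section

open MeasureTheory TopologicalSpace Set Function Filter ContinuousLinearMap
open _root_.Topology
open scoped InnerProductSpace RealInnerProductSpace ENNReal NNReal Laplacian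

namespace Literature.Analysis.FluidPDE

/-! ## Slice-wise measurability in time (joint continuity) -/

section Measurability

variable {ν T : ℝ} {f w : ℝ → EuclideanSpace ℝ (Fin 3) → EuclideanSpace ℝ (Fin 3)}
  {q : ℝ → EuclideanSpace ℝ (Fin 3) → ℝ}

/-- In the Tao class the slice dissipation `τ ↦ ∫⁻ |∇u(τ)|²` of a classical solution of the
FORCED system is a.e.-measurable on every `(s, t) ⊆ [0, T]` (joint continuity of `∇u` and
Tonelli; verbatim `aemeasurable_lintegral_frobeniusNormSq`, whose statement is tied to `f = 0`).
[folklore] -/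
private theorem aemeasurable_lintegral_frobeniusNormSq_forced (hT : 0 < T)
    (hsol : FluidPDE.IsClassicalNSSolutionOn (Icc 0 T) ν f w q) {s t : ℝ} (hs : 0 ≤ s)
    (ht : t ≤ T) :
    AEMeasurable (fun τ => ∫⁻ x, ENNReal.ofReal (FluidPDE.frobeniusNormSq (fderiv ℝ (w τ) x)))
      (volume.restrict (Ioo s t)) := by
  have hU : UniqueDiffOn ℝ (Icc 0 T) := uniqueDiffOn_Icc hT
  have cDu : ContinuousOn (fun z : ℝ × EuclideanSpace ℝ (Fin 3) => fderiv ℝ (w z.1) z.2)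
      (Ioo s t ×ˢ univ) :=
    (hsol.smooth_velocity.fderiv_slice hU).continuousOn.mono
      (prod_mono ((Ioo_subset_Icc_self).trans (Icc_subset_Icc hs ht)) Subset.rfl)
  have cF : ContinuousOn (fun z : ℝ × EuclideanSpace ℝ (Fin 3) =>
      ENNReal.ofReal (FluidPDE.frobeniusNormSq (fderiv ℝ (w z.1) z.2))) (Ioo s t ×ˢ univ) :=
    (ENNReal.continuous_ofReal.comp LerayHopfProofs.continuous_frobeniusNormSq).comp_continuousOn cDu
  have hF : AEMeasurable (fun z : ℝ × EuclideanSpace ℝ (Fin 3) =>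
      ENNReal.ofReal (FluidPDE.frobeniusNormSq (fderiv ℝ (w z.1) z.2)))
      ((volume.restrict (Ioo s t)).prod (volume : Measure (EuclideanSpace ℝ (Fin 3)))) := by
    rw [← volume_restrict_strip_fin3]
    exact cF.aemeasurable (measurableSet_Ioo.prod MeasurableSet.univ)
  exact hF.lintegral_prod_right'

/-- **Pairings of jointly continuous fields are a.e. strongly measurable in time**: for `f`, `w`
jointly continuous on `[0, T] × ℝ³`, `τ ↦ ∫⟪f τ, w τ⟫` is a.e. strongly measurable on every
`(a, b) ⊆ [0, T]` (joint continuity and Fubini; the Bochner integral's junk value is measurable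
as well). [folklore] -/
private theorem aestronglyMeasurable_integral_inner_of_continuousOn
    (hf : ContinuousOn (uncurry f) (Icc 0 T ×ˢ univ))
    (hw : ContinuousOn (uncurry w) (Icc 0 T ×ˢ univ)) {a b : ℝ} (ha : 0 ≤ a) (hb : b ≤ T) :
    AEStronglyMeasurable (fun τ => ∫ x, ⟪f τ x, w τ x⟫) (volume.restrict (Ioo a b)) := by
  have hsub : Ioo a b ×ˢ (univ : Set (EuclideanSpace ℝ (Fin 3))) ⊆ Icc 0 T ×ˢ univ :=
    prod_mono (Ioo_subset_Icc_self.trans (Icc_subset_Icc ha hb)) Subset.rfl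
  have hf' : ContinuousOn (fun z : ℝ × EuclideanSpace ℝ (Fin 3) => f z.1 z.2) (Ioo a b ×ˢ univ) :=
    hf.mono hsub
  have hw' : ContinuousOn (fun z : ℝ × EuclideanSpace ℝ (Fin 3) => w z.1 z.2) (Ioo a b ×ˢ univ) :=
    hw.mono hsub
  have hI : ContinuousOn (fun z : ℝ × EuclideanSpace ℝ (Fin 3) => ⟪f z.1 z.2, w z.1 z.2⟫)
      (Ioo a b ×ˢ univ) := hf'.inner hw'
  have h := hI.aestronglyMeasurable (μ := (volume : Measure (ℝ × EuclideanSpace ℝ (Fin 3))))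
    (measurableSet_Ioo.prod MeasurableSet.univ)
  rw [volume_restrict_strip_fin3] at h
  exact h.integral_prod_right'

end Measurability

/-! ## The work of the force and the forced source term along strong `L²` limits -/

section Work

variable {T : ℝ} {f : ℝ → EuclideanSpace ℝ (Fin 3) → EuclideanSpace ℝ (Fin 3)}
  {u : ℕ → ℝ → EuclideanSpace ℝ (Fin 3) → EuclideanSpace ℝ (Fin 3)}
  {v : ℝ → EuclideanSpace ℝ (Fin 3) → EuclideanSpace ℝ (Fin 3)}

/-- A force slice with `∫|f(t)|² ≤ C_f < ∞` has kinetic energy `½∫|f(t)|² ≤ C_f/2`. [folklore] -/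
private theorem kineticEnergy_le_half_toReal_of_lintegral_le {g : EuclideanSpace ℝ (Fin 3) → EuclideanSpace ℝ (Fin 3)}
    (hg : MemLp g 2 volume) {Cf : ℝ≥0∞} (hCft : Cf ≠ ⊤) (hCf : ∫⁻ x, ‖g x‖ₑ ^ 2 ≤ Cf) :
    VectorCalculus.kineticEnergy g ≤ Cf.toReal / 2 := by
  have h1 : FluidPDE.eEnergy g ≤ Cf := hCf
  rw [FluidPDE.eEnergy_eq_ofReal g hg] at h1
  have h2 := (ENNReal.ofReal_le_iff_le_toReal hCft).1 h1
  linarith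

/-- **The work of the force passes to strong `L²` limits** (Robinson–Rodrigo–Sadowski 2016,
proof of Thm. 4.10, the body-force term; dominated convergence in time): if `f` and the `uⁿ`
are jointly continuous on `[0, T] × ℝ³`, `∫|f(τ)|² ≤ C_f < ∞`, `E(uⁿ(τ)) ≤ M`, and
`uⁿ(τ) → v(τ)` in `L²` for every `τ ∈ [0, T]`, then
`∫ₐᵇ∫⟪f, uⁿ⟫ → ∫ₐᵇ∫⟪f, v⟫` for every `(a, b) ⊆ [0, T]`.
[cite: RobinsonRodrigoSadowski2016, proof of Thm. 4.10] -/
theorem tendsto_setIntegral_inner_force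
    (hfcont : ContinuousOn (uncurry f) (Icc 0 T ×ˢ univ))
    (hcont : ∀ n, ContinuousOn (uncurry (u n)) (Icc 0 T ×ˢ univ))
    (hfmem : ∀ t ∈ Icc 0 T, MemLp (f t) 2 volume)
    {Cf : ℝ≥0∞} (hCft : Cf ≠ ⊤) (hCf : ∀ t ∈ Icc 0 T, ∫⁻ x, ‖f t x‖ₑ ^ 2 ≤ Cf)
    (hmem : ∀ n, ∀ t ∈ Icc 0 T, MemLp (u n t) 2 volume)
    (hvmem : ∀ t ∈ Icc 0 T, MemLp (v t) 2 volume)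
    {M : ℝ} (hM : ∀ n, ∀ t ∈ Icc 0 T, VectorCalculus.kineticEnergy (u n t) ≤ M)
    (hconv : ∀ t ∈ Icc 0 T, Tendsto (fun n => eLpNorm (u n t - v t) 2 volume) atTop (𝓝 0))
    {a b : ℝ} (ha : 0 ≤ a) (hb : b ≤ T) :
    Tendsto (fun n => ∫ τ in Ioo a b, ∫ x, ⟪f τ x, u n τ x⟫) atTop
      (𝓝 (∫ τ in Ioo a b, ∫ x, ⟪f τ x, v τ x⟫)) := by
  have hIcc : ∀ {τ}, τ ∈ Ioo a b → τ ∈ Icc 0 T := fun hτ => ⟨ha.trans hτ.1.le, hτ.2.le.trans hb⟩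
  have hcomm : ∀ (τ : ℝ) (w : EuclideanSpace ℝ (Fin 3) → EuclideanSpace ℝ (Fin 3)),
      ∫ x, ⟪f τ x, w x⟫ = ∫ x, ⟪w x, f τ x⟫ := fun τ w =>
    integral_congr_ae (Eventually.of_forall fun x => real_inner_comm _ _)
  refine tendsto_integral_of_dominated_convergence (fun _ => Cf.toReal / 2 + M) (fun n => ?_) ?_
    (fun n => ?_) ?_
  · exact aestronglyMeasurable_integral_inner_of_continuousOn hfcont (hcont n) ha hb
  · exact integrableOn_const (hs := measure_Ioo_lt_top.ne) (hC := enorm_ne_top)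
  · filter_upwards [ae_restrict_mem (measurableSet_Ioo : MeasurableSet (Ioo a b))] with τ hτ
    have hτI := hIcc hτ
    rw [Real.norm_eq_abs]
    refine (abs_integral_inner_le_kineticEnergy_add (hfmem τ hτI) (hmem n τ hτI)).trans ?_
    exact add_le_add (kineticEnergy_le_half_toReal_of_lintegral_le (hfmem τ hτI) hCft (hCf τ hτI))
      (hM n τ hτI)
  · filter_upwards [ae_restrict_mem (measurableSet_Ioo : MeasurableSet (Ioo a b))] with τ hτ
    have hτI := hIcc hτ
    have h := tendsto_integral_inner_of_tendsto_eLpNorm (fun n => hmem n τ hτI) (hvmem τ hτI)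
      (hfmem τ hτI) (hconv τ hτI)
    have heq : (fun n => ∫ x, ⟪f τ x, u n τ x⟫) = fun n => ∫ x, ⟪u n τ x, f τ x⟫ :=
      funext fun n => hcomm τ (u n τ)
    rw [heq, hcomm τ (v τ)]
    exact h

end Work

/-! ## The limit is a Leray–Hopf weak solution of the forced system -/

section Assembly

variable {ν T : ℝ} {f : ℝ → EuclideanSpace ℝ (Fin 3) → EuclideanSpace ℝ (Fin 3)}
  {u : ℕ → ℝ → EuclideanSpace ℝ (Fin 3) → EuclideanSpace ℝ (Fin 3)}
  {p : ℕ → ℝ → EuclideanSpace ℝ (Fin 3) → ℝ} {u₀ : EuclideanSpace ℝ (Fin 3) → EuclideanSpace ℝ (Fin 3)}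

/-- **The forced tested slice splits off the source term**: for `w ∈ L²`, a force slice
`g ∈ L²` and a space–time test field `ψ`,
`∫ (⟪w, ∂ₜψ⟫ + ⟪w, (w·∇)ψ⟫ + ν⟪w, Δψ⟫ + ⟪g, ψ⟫) = testedSlice ν w ψ t + ∫⟪g, ψ(t)⟫`
(every summand is integrable). [folklore] -/
private theorem integral_testedSlice_add_force {w g : EuclideanSpace ℝ (Fin 3) → EuclideanSpace ℝ (Fin 3)}
    (hw : MemLp w 2 volume) (hg : MemLp g 2 volume)
    {ψ : ℝ → EuclideanSpace ℝ (Fin 3) → EuclideanSpace ℝ (Fin 3)}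
    (hψ : FluidPDE.IsSpaceTimeTestOn (⊤ : Opens (ℝ × EuclideanSpace ℝ (Fin 3))) ψ) (t : ℝ) :
    ∫ x, (⟪w x, FluidPDE.timeDeriv ψ t x⟫ + ⟪w x, FluidPDE.convect w (ψ t) x⟫ +
        ν * ⟪w x, Δ (ψ t) x⟫ + ⟪g x, ψ t x⟫) =
      testedSlice ν w ψ t + ∫ x, ⟪g x, ψ t x⟫ := by
  have ht1 : MemLp (FluidPDE.timeDeriv ψ t) 2 volume :=
    (isTestFunctionOn_slice hψ.timeDeriv_top t).memLp_volume 2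
  have ht3 : MemLp (Δ (ψ t)) 2 volume := (isTestFunctionOn_slice hψ.laplacian_top t).memLp_volume 2
  have ht0 : MemLp (ψ t) 2 volume := (isTestFunctionOn_slice hψ t).memLp_volume 2
  have hsl := isTestFunctionOn_slice hψ t
  have i1 : Integrable (fun x => ⟪w x, FluidPDE.timeDeriv ψ t x⟫) volume :=
    FluidPDE.integrable_inner_of_memLp_two hw ht1
  have i2 : Integrable (fun x => ⟪w x, fderiv ℝ (ψ t) x (w x)⟫) volume :=
    FluidPDE.integrable_inner_fderiv_apply_of_memLp_two hw hw hsl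
  have i3 : Integrable (fun x => ν * ⟪w x, Δ (ψ t) x⟫) volume :=
    (FluidPDE.integrable_inner_of_memLp_two hw ht3).const_mul ν
  have i4 : Integrable (fun x => ⟪g x, ψ t x⟫) volume := FluidPDE.integrable_inner_of_memLp_two hg ht0
  unfold testedSlice FluidPDE.convect
  exact integral_add ((i1.add i2).add i3) i4

set_option maxHeartbeats 1600000 in
/-- **Leray–Hopf solutions of the forced system as uniform `L²` limits of smooth
bounded-enstrophy solutions** (Robinson–Rodrigo–Sadowski 2016, proof of Thm. 4.10 and Thm. 6.8
with body force; Ożański–Pooley 2018, proof of Thm. 6.37, Steps 3–4; the limit step of Tao 2013,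
Thm. 5.4 (ii) for `H¹` data, inhomogeneous case; forced twin of
`exists_isLerayHopfOn_of_uniform_cauchy`). Let `uⁿ` be classical solutions on `[0, T] × ℝ³` of
the Navier–Stokes system with the SAME force `f`, `∫|f(t)|² ≤ C_f < ∞` on `[0, T]`, with
`uⁿ ∈ C([0,T]; L²)`, kinetic energies `E(uⁿ(t)) ≤ M` and enstrophies `∫|∇uⁿ(t)|² ≤ S` on
`[0, T]`, data `uⁿ(0) → u₀` in `L²`, and uniformly Cauchy in `C([0,T]; L²)`. Then there is
`v ∈ C([0,T]; L²)` with `v(0) = u₀`, `uⁿ(t) → v(t)` in `L²` for every `t ∈ [0, T]`, which is a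
Leray–Hopf weak solution of the FORCED system on `[0, T)` from `u₀`: the weak formulation (with
the source term `∫∫⟪f, ψ⟫`) passes to the limit by dominated convergence in time, the energy
inequalities (with the work term `∫ₛᵗ∫⟪f, v⟫`) by the forced energy equality of the `uⁿ`,
convergence of the kinetic energies and of the work, and the Fatou bound for weak gradients of
`L²` limits, and the continuity statements by the uniform convergence.
[cite: RobinsonRodrigoSadowski2016, proof of Thm. 4.10] -/
theorem exists_isLerayHopfOn_of_uniform_cauchy_forced (hν : 0 < ν) (hT : 0 < T)
    (hsol : ∀ n, FluidPDE.IsClassicalNSSolutionOn (Icc 0 T) ν f (u n) (p n))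
    (hc : ∀ n, FluidPDE.ContinuousInLpOn (Icc 0 T) 2 (u n))
    {Cf : ℝ≥0∞} (hCft : Cf ≠ ⊤) (hCf : ∀ t ∈ Icc 0 T, ∫⁻ x, ‖f t x‖ₑ ^ 2 ≤ Cf)
    (hu₀ : MemLp u₀ 2 volume)
    (h0 : Tendsto (fun n => eLpNorm (u n 0 - u₀) 2 volume) atTop (𝓝 0))
    (hcau : ∀ ε : ℝ≥0∞, 0 < ε → ∃ N, ∀ n ≥ N, ∀ m ≥ N, ∀ t ∈ Icc 0 T,
      eLpNorm (u n t - u m t) 2 volume ≤ ε)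
    {M : ℝ} (hM : ∀ n, ∀ t ∈ Icc 0 T, VectorCalculus.kineticEnergy (u n t) ≤ M)
    {S : ℝ≥0} (hS : ∀ n, ∀ t ∈ Icc 0 T,
      ∫⁻ x, ENNReal.ofReal (FluidPDE.frobeniusNormSq (fderiv ℝ (u n t) x)) ≤ S) :
    ∃ v : ℝ → EuclideanSpace ℝ (Fin 3) → EuclideanSpace ℝ (Fin 3),
      FluidPDE.IsLerayHopfOn T ν f u₀ v ∧ v 0 = u₀ ∧
      FluidPDE.ContinuousInLpOn (Icc 0 T) 2 v ∧
      ∀ t ∈ Icc 0 T, Tendsto (fun n => eLpNorm (u n t - v t) 2 volume) atTop (𝓝 0) := by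
  have hU : UniqueDiffOn ℝ (Icc 0 T) := uniqueDiffOn_Icc hT
  have hmem : ∀ n, ∀ t ∈ Icc 0 T, MemLp (u n t) 2 volume := fun n => (hc n).1
  have hcont : ∀ n, ContinuousOn (uncurry (u n)) (Icc 0 T ×ˢ univ) := fun n =>
    (hsol n).smooth_velocity.continuousOn
  obtain ⟨v, hv0, ⟨V, hV, hvt⟩, hvmem, hunif⟩ := exists_uniform_l2_limit hcont hmem hu₀ h0 hcau
  have hconv : ∀ t ∈ Icc 0 T, Tendsto (fun n => eLpNorm (u n t - v t) 2 volume) atTop (𝓝 0) :=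
    fun t ht => tendsto_eLpNorm_of_uniform hunif ht
  have hcv : FluidPDE.ContinuousInLpOn (Icc 0 T) 2 v := continuousInLpOn_of_uniform hc hvmem hunif
  have h0I : (0 : ℝ) ∈ Icc 0 T := left_mem_Icc.2 hT.le
  -- the force: joint continuity (the equation determines `f`) and `L²` slices
  have hfcont : ContinuousOn (uncurry f) (Icc 0 T ×ˢ univ) := (hsol 0).continuousOn_force hU
  have hfmem : ∀ t ∈ Icc 0 T, MemLp (f t) 2 volume := fun t ht =>
    memLp_two_of_lintegral_lt_top ((hsol 0).continuous_force_slice hU ht)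
      ((hCf t ht).trans_lt hCft.lt_top)
  -- kinetic energies
  have hkin : ∀ t ∈ Icc 0 T, Tendsto (fun n => VectorCalculus.kineticEnergy (u n t)) atTop
      (𝓝 (VectorCalculus.kineticEnergy (v t))) := fun t ht =>
    tendsto_kineticEnergy_of_tendsto_eLpNorm_sub (fun n => hmem n t ht) (hvmem t ht) (hconv t ht)
  have hkv : ∀ t ∈ Icc 0 T, VectorCalculus.kineticEnergy (v t) ≤ M := fun t ht =>
    le_of_tendsto' (hkin t ht) fun n => hM n t ht
  have hM0 : 0 ≤ M := (FluidPDE.kineticEnergy_nonneg _).trans (hM 0 0 h0I)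
  have heEv : ∀ t ∈ Icc 0 T, FluidPDE.eEnergy (v t) ≤ ENNReal.ofReal (2 * M) := fun t ht => by
    rw [FluidPDE.eEnergy_eq_ofReal (v t) (hvmem t ht)]
    exact ENNReal.ofReal_le_ofReal (by linarith [hkv t ht])
  have hA : ∀ n, ∀ t ∈ Icc 0 T, ∫⁻ x, ‖u n t x‖ₑ ^ 2 ≤ ENNReal.ofReal (2 * M) := by
    intro n t ht
    have h : FluidPDE.eEnergy (u n t) ≤ ENNReal.ofReal (2 * M) := by
      rw [FluidPDE.eEnergy_eq_ofReal (u n t) (hmem n t ht)]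
      exact ENNReal.ofReal_le_ofReal (by linarith [hM n t ht])
    exact h
  -- measurability of the limit on the open strip
  have hmeasv : AEStronglyMeasurable (uncurry v)
      ((volume : Measure (ℝ × EuclideanSpace ℝ (Fin 3))).restrict (Ioo 0 T ×ˢ univ)) := by
    refine hV.aestronglyMeasurable.congr ?_
    filter_upwards [ae_restrict_mem (measurableSet_Ioo.prod MeasurableSet.univ)] with z hz
    have hz0 : z.1 ≠ 0 := ne_of_gt (mem_prod.1 hz).1.1
    have h := congr_fun (hvt z.1 hz0) z.2
    simpa [uncurry] using h.symm
  -- weak gradients of the limit slices with the Fatou bound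
  set F : ℕ → ℝ → ℝ≥0∞ := fun n τ =>
    ∫⁻ x, ENNReal.ofReal (FluidPDE.frobeniusNormSq (fderiv ℝ (u n τ) x)) with hF
  have hexG : ∀ t, ∃ G : EuclideanSpace ℝ (Fin 3) → EuclideanSpace ℝ (Fin 3) →L[ℝ] EuclideanSpace ℝ (Fin 3),
      t ∈ Icc 0 T →
      FluidPDE.HasWeakGradient (v t) G ∧
        ∫⁻ x, ENNReal.ofReal (FluidPDE.frobeniusNormSq (G x)) ≤ liminf (fun n => F n t) atTop := by
    intro t
    by_cases ht : t ∈ Icc 0 T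
    · have hlim : liminf (fun n => F n t) atTop < ∞ :=
        (liminf_le_of_frequently_le' (Frequently.of_forall fun n => hS n t ht)).trans_lt
          ENNReal.coe_lt_top
      obtain ⟨G, hG, hGb⟩ := exists_hasWeakGradient_of_tendsto_eLpNorm
        (fun n => contDiff_infty.1 ((hsol n).contDiff_velocity ht) 1) (fun n => hmem n t ht) (hvmem t ht)
        (hconv t ht) hlim
      exact ⟨G, fun _ => ⟨hG, hGb⟩⟩
    · exact ⟨0, fun h => absurd h ht⟩
  choose G hG using hexG
  have hGS : ∀ t ∈ Icc 0 T, ∫⁻ x, ENNReal.ofReal (FluidPDE.frobeniusNormSq (G t x)) ≤ S := fun t ht =>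
    (hG t ht).2.trans (liminf_le_of_frequently_le' (Frequently.of_forall fun n => hS n t ht))
  -- the forced energy equality of the approximants
  have hEq : ∀ n {s t : ℝ}, 0 ≤ s → s ≤ t → t ≤ T → VectorCalculus.kineticEnergy (u n t) +
      ν * (∫⁻ τ in Ioo s t, F n τ).toReal =
      VectorCalculus.kineticEnergy (u n s) + ∫ τ in Ioo s t, ∫ x, ⟪f τ x, u n τ x⟫ :=
    fun n s t hs hst ht =>
      ((hsol n).energyEq_of_finiteEnergy_forced_L2_of_energy hν hT hCft hCf ENNReal.ofReal_ne_top
        (hA n)).2 hs hst ht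
  -- the work of the force passes to the limit
  have hW : ∀ {s t : ℝ}, 0 ≤ s → t ≤ T →
      Tendsto (fun n => ∫ τ in Ioo s t, ∫ x, ⟪f τ x, u n τ x⟫) atTop
        (𝓝 (∫ τ in Ioo s t, ∫ x, ⟪f τ x, v τ x⟫)) := fun hs ht =>
    tendsto_setIntegral_inner_force hfcont hcont hfmem hCft hCf hmem hvmem hM hconv hs ht
  -- energy inequality of the limit from every `s`, WITH the work term
  have hEI : ∀ {s t : ℝ}, 0 ≤ s → s ≤ t → t ≤ T → VectorCalculus.kineticEnergy (v t) +
      ν * (∫⁻ τ in Ioo s t, ∫⁻ x, ENNReal.ofReal (FluidPDE.frobeniusNormSq (G τ x))).toReal ≤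
      VectorCalculus.kineticEnergy (v s) + ∫ τ in Ioo s t, ∫ x, ⟪f τ x, v τ x⟫ := by
    intro s t hs hst ht
    have hsI : s ∈ Icc 0 T := ⟨hs, hst.trans ht⟩
    have htI : t ∈ Icc 0 T := ⟨hs.trans hst, ht⟩
    have hE : ∀ n, VectorCalculus.kineticEnergy (u n t) + ν * (∫⁻ τ in Ioo s t, F n τ).toReal =
        VectorCalculus.kineticEnergy (u n s) + ∫ τ in Ioo s t, ∫ x, ⟪f τ x, u n τ x⟫ :=
      fun n => hEq n hs hst ht
    have hD : ∀ n, (∫⁻ τ in Ioo s t, F n τ) ≠ ∞ := by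
      intro n
      refine ne_top_of_le_ne_top ?_ (setLIntegral_mono' measurableSet_Ioo fun τ hτ =>
        hS n τ ⟨hs.trans hτ.1.le, hτ.2.le.trans ht⟩)
      rw [setLIntegral_const]
      exact ENNReal.mul_ne_top ENNReal.coe_ne_top measure_Ioo_lt_top.ne
    have hDl : (∫⁻ τ in Ioo s t, ∫⁻ x, ENNReal.ofReal (FluidPDE.frobeniusNormSq (G τ x))) ≤
        liminf (fun n => ∫⁻ τ in Ioo s t, F n τ) atTop :=
      setLIntegral_le_liminf_of_forall_le
        (fun n => aemeasurable_lintegral_frobeniusNormSq_forced hT (hsol n) hs ht)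
        (fun τ hτ => (hG τ ⟨hs.trans hτ.1.le, hτ.2.le.trans ht⟩).2)
    exact energy_ineq_of_limit hν hE hD (hkin t htI) ((hkin s hsI).add (hW hs ht)) hDl
  -- the lift of `v` to `C([0,T]; L²)` for the continuity statements
  have hfilter : 𝓝[>] (0 : ℝ) ≤ 𝓝[Icc 0 T] 0 :=
    nhdsWithin_le_of_mem (mem_of_superset (Ioo_mem_nhdsGT hT) Ioo_subset_Icc_self)
  obtain ⟨U, hUc, hUeq⟩ := hcv.exists_continuousOn_toLp
  have hinner : ∀ {w : EuclideanSpace ℝ (Fin 3) → EuclideanSpace ℝ (Fin 3)} (hw : MemLp w 2 volume)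
      (t : ℝ) (ht : t ∈ Icc 0 T), ∫ x, ⟪v t x, w x⟫ = ⟪U t, hw.toLp w⟫ := by
    intro w hw t ht
    rw [MeasureTheory.L2.inner_def, hUeq t ht]
    exact integral_congr_ae (((hvmem t ht).coeFn_toLp).mp ((hw.coeFn_toLp).mono
      fun x h1 h2 => by dsimp only; rw [h1, h2]))
  -- the weak formulation, WITH the source term
  have hweak : FluidPDE.IsWeakNSSolutionOn T ν f u₀ v := by
    refine ⟨hmeasv, fun K _ => ?_, ?_, fun ψ hψ hdiv => ?_⟩
    · -- local square integrability on the strip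
      have hmeas' : AEStronglyMeasurable (uncurry v)
          ((volume.restrict (Ioo (0 : ℝ) T)).prod (volume : Measure (EuclideanSpace ℝ (Fin 3)))) := by
        rw [← volume_restrict_strip_fin3]; exact hmeasv
      calc ∫⁻ z in Ioo 0 T ×ˢ K, ‖uncurry v z‖ₑ ^ 2
          ≤ ∫⁻ z in Ioo 0 T ×ˢ (univ : Set (EuclideanSpace ℝ (Fin 3))), ‖uncurry v z‖ₑ ^ 2 :=
            lintegral_mono_set (prod_mono subset_rfl (subset_univ _))
        _ = ∫⁻ t in Ioo 0 T, ∫⁻ x, ‖v t x‖ₑ ^ 2 ∂(volume : Measure (EuclideanSpace ℝ (Fin 3))) := by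
            rw [volume_restrict_strip_fin3, lintegral_prod _ (hmeas'.aemeasurable.enorm.pow_const 2)]
            rfl
        _ ≤ ∫⁻ _ in Ioo 0 T, ENNReal.ofReal (2 * M) :=
            setLIntegral_mono' measurableSet_Ioo fun t ht => heEv t (Ioo_subset_Icc_self ht)
        _ < ∞ := by
            rw [setLIntegral_const]
            exact ENNReal.mul_lt_top ENNReal.ofReal_lt_top measure_Ioo_lt_top
    · -- weakly divergence free at every `t ∈ (0, T)`
      refine (ae_restrict_iff' measurableSet_Ioo).2 (Eventually.of_forall fun t ht θ hθ => ?_)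
      have htI : t ∈ Icc 0 T := Ioo_subset_Icc_self ht
      have hgc : Continuous (gradient θ) :=
        (InnerProductSpace.toDual ℝ (EuclideanSpace ℝ (Fin 3))).symm.continuous.comp
          (hθ.contDiff.continuous_fderiv (by simp))
      have hgs : HasCompactSupport (gradient θ) :=
        (hθ.hasCompactSupport.fderiv (𝕜 := ℝ)).comp_left (map_zero _)
      have hgm : MemLp (gradient θ) 2 volume := hgc.memLp_of_hasCompactSupport hgs
      have hlim := tendsto_integral_inner_of_tendsto_eLpNorm (fun n => hmem n t htI) (hvmem t htI) hgm
        (hconv t htI)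
      have hzero : ∀ n, ∫ x, ⟪u n t x, gradient θ x⟫ = 0 := fun n =>
        VectorCalculus.IsDivFree.isWeaklyDivFree_holds ((hsol n).divFree t htI)
          (contDiff_infty.1 ((hsol n).contDiff_velocity htI) 1) θ hθ
      simp_rw [hzero] at hlim
      exact tendsto_nhds_unique hlim tendsto_const_nhds
    · -- the tested identity, with the source term `∫∫⟪f, ψ⟫`
      have hψ' : FluidPDE.IsSpaceTimeTestOn (⊤ : Opens (ℝ × EuclideanSpace ℝ (Fin 3))) ψ :=
        hψ.mono le_top
      have hψcont : ContinuousOn (uncurry ψ) (Icc 0 T ×ˢ univ) := hψ'.contDiff.continuous.continuousOn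
      have hψmem : ∀ t ∈ Icc 0 T, MemLp (ψ t) 2 volume := fun t _ =>
        (isTestFunctionOn_slice hψ' t).memLp_volume 2
      obtain ⟨Bψ, hBψ⟩ := exists_kineticEnergy_slice_le hψ'
      -- identities of the approximants (classical solutions are weak solutions, same force)
      have hid : ∀ n, (∫ t in Ioo 0 T, (testedSlice ν (u n t) ψ t + ∫ x, ⟪f t x, ψ t x⟫)) +
          ∫ x, ⟪u n 0 x, ψ 0 x⟫ = 0 := by
        intro n
        have h := (IsClassicalNSSolutionOn.isWeakNSSolutionOn_holds (hsol n) Subset.rfl).2.2.2 ψ hψ hdiv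
        have heq : (∫ t in Ioo 0 T, ∫ x, (⟪u n t x, FluidPDE.timeDeriv ψ t x⟫ +
            ⟪u n t x, FluidPDE.convect (u n t) (ψ t) x⟫ + ν * ⟪u n t x, Δ (ψ t) x⟫ + ⟪f t x, ψ t x⟫)) =
            ∫ t in Ioo 0 T, (testedSlice ν (u n t) ψ t + ∫ x, ⟪f t x, ψ t x⟫) := by
          refine integral_congr_ae ?_
          filter_upwards [ae_restrict_mem (measurableSet_Ioo : MeasurableSet (Ioo (0 : ℝ) T))] with t ht
          exact integral_testedSlice_add_force (hmem n t (Ioo_subset_Icc_self ht))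
            (hfmem t (Ioo_subset_Icc_self ht)) hψ' t
        rw [heq] at h
        exact h
      -- dominated convergence in time
      obtain ⟨C, hC⟩ := exists_abs_testedSlice_le (ν := ν) hν.le hψ' M
      have hDCT : Tendsto (fun n => ∫ t in Ioo 0 T, (testedSlice ν (u n t) ψ t + ∫ x, ⟪f t x, ψ t x⟫))
          atTop (𝓝 (∫ t in Ioo 0 T, (testedSlice ν (v t) ψ t + ∫ x, ⟪f t x, ψ t x⟫))) := by
        refine tendsto_integral_of_dominated_convergence (fun _ => C + (Cf.toReal / 2 + Bψ))
          (fun n => ?_) ?_ (fun n => ?_) ?_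
        · exact (aestronglyMeasurable_testedSlice (hcont n) hψ').add
            (aestronglyMeasurable_integral_inner_of_continuousOn hfcont hψcont le_rfl le_rfl)
        · exact integrableOn_const (hs := measure_Ioo_lt_top.ne) (hC := enorm_ne_top)
        · filter_upwards [ae_restrict_mem (measurableSet_Ioo : MeasurableSet (Ioo (0 : ℝ) T))] with t ht
          have htI : t ∈ Icc 0 T := Ioo_subset_Icc_self ht
          rw [Real.norm_eq_abs]
          refine (abs_add_le _ _).trans (add_le_add ?_ ?_)
          · exact hC (u n t) (hmem n t htI) (hM n t htI) t
          · refine (abs_integral_inner_le_kineticEnergy_add (hfmem t htI) (hψmem t htI)).trans ?_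
            exact add_le_add (kineticEnergy_le_half_toReal_of_lintegral_le (hfmem t htI) hCft (hCf t htI))
              (hBψ t)
        · filter_upwards [ae_restrict_mem (measurableSet_Ioo : MeasurableSet (Ioo (0 : ℝ) T))] with t ht
          exact (tendsto_testedSlice (fun n => hmem n t (Ioo_subset_Icc_self ht))
            (hvmem t (Ioo_subset_Icc_self ht)) (hconv t (Ioo_subset_Icc_self ht)) hψ' t).add
            tendsto_const_nhds
      have hψ0 : MemLp (ψ 0) 2 volume := (isTestFunctionOn_slice hψ' 0).memLp_volume 2
      have hdat : Tendsto (fun n => ∫ x, ⟪u n 0 x, ψ 0 x⟫) atTop (𝓝 (∫ x, ⟪u₀ x, ψ 0 x⟫)) :=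
        tendsto_integral_inner_of_tendsto_eLpNorm (fun n => hmem n 0 h0I) hu₀ hψ0 h0
      have hsum := hDCT.add hdat
      simp_rw [hid] at hsum
      have hfin : (∫ t in Ioo 0 T, (testedSlice ν (v t) ψ t + ∫ x, ⟪f t x, ψ t x⟫)) +
          ∫ x, ⟪u₀ x, ψ 0 x⟫ = 0 :=
        (tendsto_nhds_unique tendsto_const_nhds hsum).symm
      have heqv : (∫ t in Ioo 0 T, ∫ x, (⟪v t x, FluidPDE.timeDeriv ψ t x⟫ +
          ⟪v t x, FluidPDE.convect (v t) (ψ t) x⟫ + ν * ⟪v t x, Δ (ψ t) x⟫ + ⟪f t x, ψ t x⟫)) =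
          ∫ t in Ioo 0 T, (testedSlice ν (v t) ψ t + ∫ x, ⟪f t x, ψ t x⟫) := by
        refine integral_congr_ae ?_
        filter_upwards [ae_restrict_mem (measurableSet_Ioo : MeasurableSet (Ioo (0 : ℝ) T))] with t ht
        exact integral_testedSlice_add_force (hvmem t (Ioo_subset_Icc_self ht))
          (hfmem t (Ioo_subset_Icc_self ht)) hψ' t
      rw [heqv]
      exact hfin
  refine ⟨v, ⟨hweak, ⟨(2 * M).toNNReal, ?_⟩, hvmem, ⟨G, ?_, ?_, fun t ht => ?_, ?_⟩, fun w hw => ⟨?_, ?_⟩, ?_⟩,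
    hv0, hcv, hconv⟩
  · -- energy bound a.e. on `(0, T)`
    exact (ae_restrict_iff' measurableSet_Ioo).2 (Eventually.of_forall fun t ht =>
      heEv t (Ioo_subset_Icc_self ht))
  · -- weak gradients a.e.
    exact (ae_restrict_iff' measurableSet_Ioo).2 (Eventually.of_forall fun t ht =>
      (hG t (Ioo_subset_Icc_self ht)).1)
  · -- the dissipation is finite
    calc ∫⁻ t in Ioo 0 T, ∫⁻ x, ENNReal.ofReal (FluidPDE.frobeniusNormSq (G t x))
        ≤ ∫⁻ _ in Ioo 0 T, (S : ℝ≥0∞) :=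
          setLIntegral_mono' measurableSet_Ioo fun t ht => hGS t (Ioo_subset_Icc_self ht)
      _ < ∞ := by
          rw [setLIntegral_const]
          exact ENNReal.mul_lt_top ENNReal.coe_lt_top measure_Ioo_lt_top
  · -- energy inequality from `0`, WITH the work of the force
    have h := hEI le_rfl ht.1 ht.2
    rw [intervalIntegral.integral_of_le ht.1, integral_Ioc_eq_integral_Ioo, ← hv0]
    exact h
  · -- energy inequality from every `s ∈ (0, T)`, WITH the work of the force
    refine (ae_restrict_iff' measurableSet_Ioo).2 (Eventually.of_forall fun s hs t ht => ?_)
    have h := hEI hs.1.le ht.1 ht.2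
    rw [intervalIntegral.integral_of_le ht.1, integral_Ioc_eq_integral_Ioo]
    exact h
  · -- weak continuity on `(0, T]`
    have hcU : ContinuousOn (fun t => ⟪U t, hw.toLp w⟫) (Icc 0 T) := hUc.inner continuousOn_const
    exact (hcU.congr fun t ht => hinner hw t ht).mono Ioc_subset_Icc_self
  · -- weak attainment of the datum
    have hcU : ContinuousWithinAt (fun t => ⟪U t, hw.toLp w⟫) (Icc 0 T) 0 :=
      (hUc.inner continuousOn_const) 0 h0I
    rw [← hv0, hinner hw 0 h0I]
    refine ((hcU.tendsto.congr' ?_).mono_left hfilter)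
    exact eventually_mem_nhdsWithin.mono fun t ht => (hinner hw t ht).symm
  · -- strong attainment of the datum
    rw [← hv0]
    exact (hcv.2 0 h0I).mono_left hfilter

end Assembly

end Literature.Analysis.FluidPDE

end
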